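import Summits.QuantumFields.BalabanUV.T4Continuum.Spine.NE1p.DressedTowerWitnessSliceEnd

/-!
# T⁴ programme, spine estimate NE1′ (node O3b/H2) — LIVE REGENERATION (w5) AT EVERY CUTOFF, part 1: a cell with `c̄ > 0`, a
# family re-generating at EVERY step at the maximal booked rate, its K+1 generations carried at function level (formalisation
# crew `b2b-balaban-t4-ne1p-formalise-*`, leaf seat 03, generation 3, witness item W10; own-initiative consistency item, NOT a crew
# estimate row; INTENT CLAIMS.log 2026-08-20T10:34Z)

Cell `pub-balaban`, sub-cell `t4`, BINDER-OWNERS row NE1′ (owner lineage t4-ne1p-p1).  ADDITIVE — imports this seat's row W7 part 2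
`Spine/NE1p/DressedTowerWitnessSliceEnd` (p214558: the ONE cutoff-free schedule `Wm`, `c_M`, the two-atom laws `flAt (atomW (k+1))`, the
schedule lemmas `hDμM` ∕ `hz₁M` ∕ `hδfwkM` ∕ `hdefwkM` ∕ `hrateM` ∕ `relGauge_pairs` ∕ `zero_mem_windowM`; through it row W5's `LW`, `ψ = LW⁻²`,
`defW`, `dirW`, `wOp_flAt`, `realBaseAt_W` and row S3's `uniformConstantsCell` ∕ `locCell` ∕ `rhoOne`) ONLY; modifies nothing.

WHY.  In every witness of the crew (W1–W9, W5c, W7c, W8) the (w5) family is inhabited TRIVIALLY: regeneration constants `creg ≡ 0`,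
cell constant `c̄ = 0`, ONE generation per family («no regeneration»).  Hence the `C·c̄` term of the family factor
`rhoOne ψ C c̄ κ = ψ·alphaCell κ + C·c̄` and the `L·C·c̄` term of row S3's located largeness `locCell L C c̄ κ = alphaCell κ∕L + L·C·c̄ ≤ ρ′ < 1`
(the trigger's caveat k2: `e³∕L + L⁴·C·c̄·L⁻² < 1`) were never exercised with `c̄ ≠ 0`, and END-B's closed loop (transport × regeneration ×
convention (A), `T4TrajectoryComparison`) never ran with a live regeneration.  This item does that, UNIFORMLY IN THE CUTOFF.

THE DATUM (this part).
* §1 a NEW K-free cell **`UR := uniformConstantsCell LW 2 c̄_R ½ 1 1 ⅛ ½ ¾`** with **`c̄_R := (8·LW)⁻¹ > 0`**: located largeness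
  `locCell LW 2 c̄_R ½ = ½ + ¼ = ¾ = ρ′` (BOTH terms live, EQUALITY — `locCell_R`), (w6) window `⅛·(1·1·(1−¾)⁻¹) = ½ ≤ 1 − ½`
  (EQUALITY — `hsmallR`), family factor `ρ₁ = rhoOne ψ 2 c̄_R ½ = 3∕(4·LW) < 1` (`rhoOne_R`).
* §2 on row W7's one-family booking GEOMETRY (cubes `Fin (K+1)`, birth scale `0`, the ONE cutoff-free `Wm`) a trajectory with a LIVE
  GENERATION AT EVERY SCALE: `gen b 0 = τ^K∕2` (`C·gen` = the class at birth, equality); **`gen b (k+1) := c̄_R · size b k`** —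
  REGENERATION AT THE MAXIMAL BOOKED RATE (`hreg` with EQUALITY, `hregR`; `creg k = c̄_R` so `hcb` is an equality too); re-linearised
  sizes `lin b k′ k = gen b k′ · q_k`, `q_k := (ψ^{k+1}∕2)∕(c_M + 3)`; booked size **`size b k := Σ_{k′ ≤ k} lin b k′ k`** (convention (A)
  with EQUALITY) — the generation partial sums `S_{k+1} = S_k·(1 + c̄_R·q_k)` by recursion (`SR`, `sum_gR`): booking `BR K`,
  trajectory `TR K`, tower `towerR`.  Every generation at every scale is POSITIVE (`gR_pos`).
* §3 carried functionals for EVERY generation: `FnR K k′ k U = (gen b k′∕(c_M+3))·(U₀₀ + sh k − sh k′)`, `sh (k+1) = sh k + ψ^{k+1}∕8`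
  (the accumulated dressing of the plain two-point average); `hFn` AS AN EQUATION for every `k′` (`FnR_succ`, by row W5's `wOp_flAt`);
  births `hslR` for every `k′` (bound `gen b k′` on the window `bondBall (c_M ψ^{k′})`); attainment `hlinR` for every `k′` along row
  W5's `dirW (k+1)`; `hbirthR` (any gate); `hregR` (any gate, EQUALITY); counts.
Part 2 (`DressedTowerWitnessRegenEnd`) feeds these to leaf-04's assembled slice-window END BY NAME and closes the root by END-B.

DECLARED DEGENERACIES.  Action exponent `𝒜 ≡ 0`, observable coupling `c := 0`, action margins `s ≡ 0`, `ref = id` here (the live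
(w2-act) corner is W9's, the live-`𝒬` corner W7's); `rel = Eq`; two-atom laws; one family (so (w3-book) `hcount` is `1 ≤ N₀·Λ^{k−j}`).
A decided toy: [folklore] kernel mathematics, 0 sorry, 0 citations, no `def … : Prop`; NOTHING of Bałaban's (w5) constant, of
[Balaban1989LargeFieldII] (1.89) or of the renewal structure of the real densities is encoded (CONTEXT only).

HONEST FRAMING.  Headline (c4): «the (w5) family `hreg`∕`hc0`∕`hcb` and the `c̄`-terms of `rhoOne`∕`locCell` are inhabitable
NON-TRIVIALLY at every cutoff, jointly with every other family of END-F′ ∕ END-B, ONE K-free `U` — non-vacuity of SHAPES; NE1′ ⇐ the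
named binders, NOT proved»; spine PROVED 0∕9.  Rung (B)+1 on ONE finite four-torus — NOT infinite volume, NOT a mass gap, NOT OS on ℝ⁴,
NOT Clay, NOT summit progress.  HONEST DEPENDENCY: continuum YM on T⁴ ⇐ BetaPertH ∧ nine spine estimates (0/9 proved); BetaPertH ⇐
(D1) ∧ (D4) ∧ CAP+tail; G-an2-4 gates asym, D1 and NE2/3/4.
-/

noncomputable section

namespace Summit.QuantumFields.BalabanUV.T4Continuum.NE1p.DressedTowerWitnessRegen

open MeasureTheory Set Metric Filter Finset
open scoped BigOperators
open Literature.MathematicalPhysics.QuantumFieldTheory.Balaban1983to89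
open Literature.MathematicalPhysics.QuantumFieldTheory.Balaban1983to89.T4TermFormat
open Literature.MathematicalPhysics.QuantumFieldTheory.Balaban1983to89.T4TermFormat.Booking
open Literature.MathematicalPhysics.QuantumFieldTheory.Balaban1983to89.T4GatedBooking
open Literature.MathematicalPhysics.QuantumFieldTheory.Balaban1983to89.T4TrajectoryComparison
open T4TrajectoryModulus (bondBall bondBall_add_mem bondBall_latMove_add_mem bondBall_diam)
open T4BlockTransport (Fld NDir latMove latN Site norm_dir_le)
open T4BirthChartTransport (GaugeInvariant BirthSlice RelGauge)
open T4TrajectoryDensity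
open Summit.QuantumFields.BalabanUV.T4Continuum.T4TrajectoryDensityDressed
open Summit.QuantumFields.BalabanUV.T4Continuum.T4TrajectoryDensityWitness
open Summit.QuantumFields.BalabanUV.T4Continuum.NE1p.DressedRoot
open Summit.QuantumFields.BalabanUV.T4Continuum.NE1p.DressedUniformConstants
open Summit.QuantumFields.BalabanUV.T4Continuum.NE1p.DressedWindowScheduleWin
open Summit.QuantumFields.BalabanUV.T4Continuum.NE1p.DressedWindowScheduleModWin
open Summit.QuantumFields.BalabanUV.T4Continuum.NE1p.DressedTowerWitness
open Summit.QuantumFields.BalabanUV.T4Continuum.NE1p.DressedTowerWitnessSlice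

/-! ## §1 The cell with a LIVE regeneration constant [decided toy] -/

/-- **THE REGENERATION CONSTANT OF THE CELL** `c̄_R := (8·L)⁻¹ > 0` — chosen so that the located largeness closes with BOTH terms live:
`alphaCell ½∕L + L·2·c̄_R = ½ + ¼`. (A toy choice, NOT Bałaban's (w5) constant.) [folklore] -/
def cbarR : ℝ := (8 * LW)⁻¹

/-- [arith] [folklore] -/ theorem cbarR_pos : 0 < cbarR := by unfold cbarR; have := LW_pos; positivity

/-- **THE LOCATED LARGENESS WITH BOTH TERMS LIVE** [folklore]: `locCell LW 2 c̄_R ½ = alphaCell ½∕LW + LW·2·c̄_R = ½ + ¼ = ¾`. -/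
theorem locCell_R : locCell LW (4 * (1 / 2) / 1) cbarR (1 / 2) = 3 / 4 := by
  have hα : 0 < alphaCell (1 / 2) := alphaCell_pos (by norm_num)
  have hL : LW = 2 * alphaCell (1 / 2) := rfl
  unfold locCell cbarR
  rw [hL]
  field_simp
  ring

/-- [arith] The `L·C·c̄` term alone: `LW·2·c̄_R = ¼` (live). [folklore] -/
theorem LCcbar_R : LW * (4 * (1 / 2) / 1) * cbarR = 1 / 4 := by
  have hL := LW_pos
  unfold cbarR
  field_simp
  ring

/-- **THE (w6) WINDOW OF THE CELL, AN EQUALITY** [folklore]: `m·(N₀A₀∕(1−ρ′)) = ⅛·4 = ½ ≤ 1 − s̄⁰ = ½`. -/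
theorem hsmallR : (1 / 8 : ℝ) * (1 * 1 * (1 - 3 / 4)⁻¹) ≤ 1 - 1 / 2 := by norm_num

/-- **THE ONE K-FREE CONSTANT SET WITH LIVE REGENERATION** [decided toy]: `(L, C, c̄, κ, N₀, A₀, m, s̄⁰, ρ′) = (LW, 2, (8LW)⁻¹, ½, 1, 1,
⅛, ½, ¾)` through row S3's `uniformConstantsCell` (so `Λ = LW⁴`, `ρ₁ = rhoOne ψ 2 c̄_R ½`, `τ = LW⁻³`, (w7) by `locCell_R`).  It
precedes `∀ K`. [folklore] -/
def UR : UniformConstants :=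
  uniformConstantsCell LW (4 * (1 / 2) / 1) cbarR (1 / 2) 1 1 (1 / 8) (1 / 2) (3 / 4) one_le_LW (by norm_num) cbarR_pos.le
    (by norm_num) zero_le_one zero_le_one (by norm_num) locCell_R.le (by norm_num) hsmallR

/-- **THE FAMILY FACTOR WITH ITS `C·c̄` TERM LIVE** [folklore]: `ρ₁ = ψ·alphaCell ½ + 2·c̄_R = 1∕(2LW) + 1∕(4LW) = 3∕(4LW)`. -/
theorem rhoOne_R : rhoOne (LW ^ 2)⁻¹ (4 * (1 / 2) / 1) cbarR (1 / 2) = 3 / (4 * LW) := by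
  have hα : 0 < alphaCell (1 / 2) := alphaCell_pos (by norm_num)
  have hL : LW = 2 * alphaCell (1 / 2) := rfl
  unfold rhoOne cbarR
  rw [hL]
  field_simp
  ring

/-- [folklore] … and it is `< 1` (`LW ≥ 2`): the class decays along the family even with live regeneration. -/
theorem rhoOne_R_lt_one : rhoOne (LW ^ 2)⁻¹ (4 * (1 / 2) / 1) cbarR (1 / 2) < 1 := by
  rw [rhoOne_R, div_lt_one (by linarith [two_le_LW])]
  linarith [two_le_LW]

/-! ## §2 Generations, sizes, booking and trajectory with regeneration at every step [decided toy] -/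

/-- The per-unit-generation re-linearised size at scale `k`: `q_k := (ψ^{k+1}∕2)∕(c_M + 3)` (`lin b k′ k = gen b k′ · q_k`). [folklore] -/
def qR (k : ℕ) : ℝ := defW (k + 1) / (cM + 3)

/-- [arith] [folklore] -/ theorem qR_pos (k : ℕ) : 0 < qR k := div_pos (defW_pos (k + 1)) (by linarith [cM_pos])

/-- THE GENERATION PARTIAL SUMS at cutoff `K` [decided toy]: `S_0 = τ^K∕2`, `S_{k+1} = S_k·(1 + c̄_R·q_k)`. [folklore] -/
def SR (K : ℕ) : ℕ → ℝ
  | 0 => (LW⁻¹ ^ 3) ^ K / 2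
  | k + 1 => SR K k * (1 + cbarR * qR k)

/-- THE GENERATIONS at cutoff `K` [decided toy]: the birth `gen b 0 = τ^K∕2`, and at EVERY later scale the regenerated generation
`gen b (k+1) = c̄_R·(q_k·S_k) = c̄_R · size b k`. [folklore] -/
def gR (K : ℕ) : ℕ → ℝ
  | 0 => (LW⁻¹ ^ 3) ^ K / 2
  | k + 1 => cbarR * (qR k * SR K k)

/-- THE BOOKED SIZE at scale `k` [decided toy]: `size b k = q_k · S_k = Σ_{k′ ≤ k} lin b k′ k`. [folklore] -/
def sizeR (K k : ℕ) : ℝ := qR k * SR K k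

/-- [arith] [folklore] -/
theorem SR_pos (K : ℕ) : ∀ k, 0 < SR K k
  | 0 => by simp only [SR]; have := LW_pos; positivity
  | k + 1 => by
    simp only [SR]
    exact mul_pos (SR_pos K k) (by have := cbarR_pos; have := qR_pos k; positivity)

/-- [arith] [folklore] Every generation at every scale is POSITIVE — the regeneration is live. -/
theorem gR_pos (K : ℕ) : ∀ k, 0 < gR K k
  | 0 => by simp only [gR]; have := LW_pos; positivity
  | k + 1 => by simp only [gR]; exact mul_pos cbarR_pos (mul_pos (qR_pos k) (SR_pos K k))

/-- [arith] [folklore] -/ theorem sizeR_pos (K k : ℕ) : 0 < sizeR K k := mul_pos (qR_pos k) (SR_pos K k)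

/-- [arith] [folklore] The partial sums ARE partial sums: `S_{k+1} = S_k + gen (k+1)`. -/
theorem SR_succ (K k : ℕ) : SR K (k + 1) = SR K k + gR K (k + 1) := by
  simp only [SR, gR]; ring

/-- [folklore] `Σ_{k′ ≤ k} gen b k′ = S_k`. -/
theorem sum_gR (K : ℕ) : ∀ k, ∑ k' ∈ Icc 0 k, gR K k' = SR K k
  | 0 => by simp [gR, SR]
  | k + 1 => by rw [Finset.sum_Icc_succ_top (Nat.zero_le _), sum_gR K k, SR_succ]

/-- TOY BOOKING at cutoff `K` [decided toy]: row W7's one-family geometry (born at scale `0`, one cube per scale, felt everywhere) with the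
booked sizes `size b k = q_k·S_k` of the regenerating trajectory.  Nothing of Bałaban's is modelled. [folklore] -/
def BR (K : ℕ) : T4TermFormat.Booking where
  K := K
  Dom := Unit
  domScale := fun _ => 0
  treeLen := fun _ => 0
  treeLen_nonneg := fun _ => le_rfl
  balSize := fun _ => 0
  Birth := Unit
  births := {()}
  mem_births := fun b => by simp
  birthScale := fun _ => 0
  birth_le := fun _ => Nat.zero_le K
  loc := fun _ => ()
  loc_scale := fun _ => rfl
  Cube := Fin (K + 1)
  cubes := Finset.univ
  mem_cubes := fun q => Finset.mem_univ q
  cubeScale := fun q => q.val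
  cube_le := fun q => Nat.lt_succ_iff.mp q.isLt
  feltAt := fun _ => {()}
  felt_birth_le := fun _ _ _ => Nat.zero_le _
  size := fun _ k => sizeR K k
  size_nonneg := fun _ k => (sizeR_pos K k).le
  pair := fun _ _ _ => 0

/-- TOY TRAJECTORY WITH REGENERATION AT EVERY STEP [decided toy]: a live generation `gen b k′ = gR K k′ > 0` at EVERY scale `k′`,
re-linearised sizes `lin b k′ k = gen b k′ · q_k`, convention (A) `size b k ≤ Σ_{k′ ≤ k} lin b k′ k` with EQUALITY (`sum_gR`). [folklore] -/
def TR (K : ℕ) : Trajectory (BR K) where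
  lin := fun _ k' k => gR K k' * qR k
  lin_nonneg := fun _ k' k => (mul_pos (gR_pos K k') (qR_pos k)).le
  gen := fun _ k' => gR K k'
  gen_nonneg := fun _ k' => (gR_pos K k').le
  size_le := fun b k _ _ => by
    show sizeR K k ≤ ∑ k' ∈ Icc 0 k, gR K k' * qR k
    rw [← Finset.sum_mul, sum_gR, sizeR, mul_comm]

/-- TOY TOWER [decided toy]: the regenerating datum at every cutoff (one run parameter). [folklore] -/
def towerR : DressedTower Unit where
  B := fun _ K => BR K
  K_eq := fun _ _ => rfl
  T := fun _ K => TR K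

/-- **REGENERATION AT THE MAXIMAL BOOKED RATE** [folklore]: `gen b (k+1) = c̄_R · size b k` — the (w5) shape `hreg` will hold with
EQUALITY at every step of every cutoff. -/
theorem gen_succ_eq (K k : ℕ) (b : (BR K).Birth) : (TR K).gen b (k + 1) = cbarR * (BR K).size b k := rfl

/-- [folklore] The regeneration is LIVE: a positive new generation at every later scale of every cutoff. -/
theorem regeneration_live (K k : ℕ) (b : (BR K).Birth) : 0 < (TR K).gen b (k + 1) := gR_pos K (k + 1)

/-! ## §3 The carried functionals of EVERY generation and the END binders on the datum [folklore] -/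

/-- The accumulated dressing of the plain two-point average: `sh 0 = 0`, `sh (k+1) = sh k + ψ^{k+1}∕8`. [folklore] -/
def shR : ℕ → ℂ
  | 0 => 0
  | k + 1 => shR k + (((((LW ^ 2)⁻¹) ^ (k + 1)) / 8 : ℝ) : ℂ)

/-- The amplitude of generation `k′`: `gen b k′∕(c_M + 3)` (so that the birth slice bound on the birth window is `gen b k′`). [folklore] -/
def ampR (K k' : ℕ) : ℝ := gR K k' / (cM + 3)

/-- [arith] [folklore] -/ theorem ampR_pos (K k' : ℕ) : 0 < ampR K k' := div_pos (gR_pos K k') (by linarith [cM_pos])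

/-- THE CARRIED FUNCTIONALS OF EVERY GENERATION at cutoff `K` [decided toy]: generation `k′` at scale `k` is
`amp_{k′}·(U₀₀ + sh k − sh k′)` — born undressed at `k = k′`, dressed by every later step. [folklore] -/
def FnR (K : ℕ) (k' k : ℕ) (U : Fld 4 ℂ) : ℂ := (ampR K k' : ℂ) * (ev₀₀ U + (shR k - shR k'))

/-- `hFn` AS AN EQUATION FOR EVERY GENERATION: the step `k → k+1` is the dressed operation (trivial action weights, two-atom law
`δ_0 + δ_{z_k}`) on the translates — a genuine averaging step (row W5's `wOp_flAt`). [folklore] -/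
theorem FnR_succ (K k' k : ℕ) (U : Fld 4 ℂ) :
    FnR K k' (k + 1) U =
      wOp (expWeight base₁ (zeroExp + zeroExp)) (flAt (atomW (k + 1))) 0 U (fun z => FnR K k' k (U + z)) := by
  rw [wOp_flAt]
  simp only [FnR, shR, ev₀₀_add, ev₀₀_atomW, add_zero]
  push_cast
  ring

/-- `hsl` (w1) FOR EVERY GENERATION: at its own scale generation `k′` is `amp_{k′}·U₀₀`, entire along every chart and bounded by
`amp_{k′}·(c_M ψ^{k′} + 3) ≤ gen b k′` on the discs over the window `bondBall (c_M ψ^{k′})`. [folklore] -/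
theorem hslR (K : ℕ) (b : (BR K).Birth) (k' : ℕ) :
    BirthSlice (FnR K k' k') latMove latN (bondBall 4 (Wm.ρw k') : Set (Fld 4 ℂ)) 1 1 ((TR K).gen b k') := by
  intro U hU p hp hp1
  have hUc : ‖ev₀₀ U‖ ≤ cM :=
    (hU 0 0).trans (by rw [Wm_ρw]; exact mul_le_of_le_one_right cM_pos.le (psi_pow_le_one k'))
  refine ⟨ball 0 (3 / latN p), ?_, fun t ht => ?_, discs_subset_ball hp hp1 (by norm_num)⟩
  · simp only [FnR, ev₀₀_latMove]; fun_prop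
  · show ‖FnR K k' k' (latMove U p t)‖ ≤ gR K k'
    simp only [FnR, ev₀₀_latMove, sub_self, add_zero]
    have h3 := norm_t_mul_le p hp ht
    rw [norm_mul, Complex.norm_real, Real.norm_eq_abs, abs_of_pos (ampR_pos K k')]
    calc ampR K k' * ‖ev₀₀ U + t * ev₀₀ p.1.1‖ ≤ ampR K k' * (‖ev₀₀ U‖ + ‖t * ev₀₀ p.1.1‖) :=
          mul_le_mul_of_nonneg_left (norm_add_le _ _) (ampR_pos K k').le
      _ ≤ ampR K k' * (cM + 3) := mul_le_mul_of_nonneg_left (by linarith) (ampR_pos K k').le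
      _ = gR K k' := by unfold ampR; rw [div_mul_cancel₀ _ (by linarith [cM_pos] : cM + 3 ≠ 0)]

/-- **`hlin` FOR EVERY GENERATION — THE CURRENCY FROM THE CARRIED FUNCTIONALS**: base `0 ∈ 𝒦`, gauge image `δ_{k+1}·e₀₀` along row W5's
`dirW (k+1)` (defect `ψ^{k+1}∕2`), and `lin b k′ k = gen b k′·q_k = amp_{k′}·δ_{k+1}` is EXACTLY the oscillation (the dressing cancels
in differences). [folklore] -/
theorem hlinR (K : ℕ) (b : (BR K).Birth) (k' k : ℕ) (ε : ℝ) (hε : 0 < ε) :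
    ∃ U₀ ∈ (bondBall 4 (Wm.ρw k) : Set (Fld 4 ℂ)), ∃ U₁ : Fld 4 ℂ,
      RelGauge (fun U U' : Fld 4 ℂ => U = U') latMove latN U₀ U₁ (defW (k + 1)) ∧
        (TR K).lin b k' k ≤ ‖FnR K k' k U₁ - FnR K k' k U₀‖ + ε := by
  refine ⟨0, zero_mem_windowM k, latMove 0 (dirW (k + 1)) 1, ⟨dirW (k + 1), defW_pos (k + 1), le_rfl, rfl⟩, ?_⟩
  show gR K k' * qR k ≤ _
  have hq : gR K k' * qR k = ampR K k' * defW (k + 1) := by unfold qR ampR; ring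
  simp only [FnR, ev₀₀_move_dirW, ev₀₀_zero, zero_add]
  rw [show (ampR K k' : ℂ) * (((defW (k + 1) : ℝ) : ℂ) + (shR k - shR k')) - (ampR K k' : ℂ) * (shR k - shR k') =
      ((ampR K k' * defW (k + 1) : ℝ) : ℂ) by push_cast; ring,
    Complex.norm_real, Real.norm_eq_abs, abs_of_pos (mul_pos (ampR_pos K k') (defW_pos (k + 1)))]
  linarith

/-- (w1)+(w5b) `hbirth` for ANY gate, by `birthsFromOld_of_diag`: `C·gen b 0 = 2·τ^K∕2 = τ^K = twoRate 1 ρ₁ τ K 0 0` EXACTLY — the class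
is met with equality at birth. [folklore] -/
theorem hbirthR (K : ℕ) (Gate : ℕ → Prop) :
    (TR K).BirthsFromOld (4 * (1 / 2) / 1) (fun _ : ℕ => (LW ^ 2)⁻¹ * alphaCell (1 / 2))
      (twoRate 1 (rhoOne (LW ^ 2)⁻¹ (4 * (1 / 2) / 1) cbarR (1 / 2)) (LW⁻¹ ^ 3) (BR K).K) Gate :=
  Trajectory.birthsFromOld_of_diag fun b => by
    show 4 * (1 / 2) / 1 * gR K 0 ≤ twoRate 1 (rhoOne (LW ^ 2)⁻¹ (4 * (1 / 2) / 1) cbarR (1 / 2)) (LW⁻¹ ^ 3) K 0 0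
    simp only [gR, twoRate, Nat.sub_zero, pow_zero, mul_one, one_mul]
    linarith

/-- **(w5) `hreg` WITH EQUALITY, FOR ANY GATE** [folklore]: `gen b (k+1) ≤ c̄_R · size b k` holds as `gen b (k+1) = c̄_R · size b k` —
regeneration at the MAXIMAL rate the cell books (`creg k = c̄_R = c̄`). -/
theorem hregR (K : ℕ) (Gate : ℕ → Prop) : (TR K).RegeneratesFromVar (fun _ : ℕ => cbarR) Gate :=
  fun b k _ _ _ => (gen_succ_eq K k b).le

/-- (w3-book) `hcount`: one live family, `N₀ = 1`, `Λ = LW⁴ ≥ 1`. [folklore] -/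
theorem hcountR (K : ℕ) : ∀ (k : ℕ) (b : (BR K).Birth), ∀ j ≤ k,
    (((({b} : Finset (BR K).Birth)).filter fun f => (BR K).birthScale f = j).card : ℝ) ≤ 1 * (LW ^ 4) ^ (k - j) := by
  intro k b j _
  have h1 : (((({b} : Finset (BR K).Birth)).filter fun f => (BR K).birthScale f = j).card : ℝ) ≤ 1 := by
    exact_mod_cast (Finset.card_filter_le _ _).trans (Finset.card_singleton b).le
  exact h1.trans (by simpa using one_le_pow₀ (M₀ := ℝ) (a := LW ^ 4) (n := k - j) (one_le_pow₀ one_le_LW))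

/-- `hSg`: the live generation of the met component of `b` in the (here uncoupled, `c := 0`) observable exponent is `(b, 0)`. [folklore] -/
theorem hSgR (K : ℕ) : ∀ (k : ℕ) (b : (BR K).Birth), ∀ p ∈ ({(b, 0)} : Finset ((BR K).Birth × ℕ)),
    p.1 ∈ ({b} : Finset (BR K).Birth) ∧ (BR K).birthScale p.1 ≤ p.2 ∧ p.2 ≤ k := by
  intro k b p hp
  rw [Finset.mem_singleton] at hp
  subst hp
  exact ⟨Finset.mem_singleton_self _, le_rfl, Nat.zero_le _⟩

/-- `hδf` (I4′) on this booking: row W7's fresh defect `ψ^{k+1}∕4 ≤ ½·ψ^{k−0}`. [folklore] -/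
theorem hδfR (K : ℕ) : ∀ (k : ℕ) (b : (BR K).Birth), ∀ p ∈ ({(b, 0)} : Finset ((BR K).Birth × ℕ)),
    0 ≤ dfW k ∧ dfW k ≤ 1 / 2 * ((LW ^ 2)⁻¹) ^ (k - p.2) := by
  intro k b p hp
  rw [Finset.mem_singleton] at hp
  subst hp
  refine ⟨(dfW_pos k).le, ?_⟩
  show ((LW ^ 2)⁻¹) ^ (k + 1) / 4 ≤ 1 / 2 * ((LW ^ 2)⁻¹) ^ (k - 0)
  rw [Nat.sub_zero, pow_succ]
  have h0 : 0 ≤ ((LW ^ 2)⁻¹) ^ k := pow_nonneg psi_pos.le k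
  have h1 := psi_le_one
  nlinarith

/-- (w4) `hdom` on this booking, DISCHARGED by the schedule's constant ratio (`hratioM`) through row S3's `hdom_cell`. [folklore] -/
theorem hdomR (K k : ℕ) (_hk : k + 1 ≤ (BR K).K) :
    Real.exp 3 * (1 + 4 * (2 * Wm.σ k) / Wm.ϱc k) ≤ (fun _ : ℕ => alphaCell (1 / 2)) k :=
  hdom_cell (Wm.hϱc k) (hratioM k)

/-- [decided toy] ROOT-B's count datum: one family felt per cube, `PositionalCount (1·(LW⁴)^{k−j})` at every cutoff. [folklore] -/
theorem positionalCount_towerR (K : ℕ) : (BR K).PositionalCount fun j k => 1 * (LW ^ 4) ^ (k - j) := by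
  intro q j
  have h1 : (((BR K).feltOfScale q j).card : ℝ) ≤ 1 := by
    exact_mod_cast (Finset.card_filter_le _ _).trans (Finset.card_singleton ()).le
  exact h1.trans (by simpa using one_le_pow₀ (M₀ := ℝ) (a := LW ^ 4) (n := (BR K).cubeScale q - j) (one_le_pow₀ one_le_LW))

/-- The dressing genuinely acts on every generation: `FnR K k′ (k′+1) ≠ FnR K k′ k′` (`sh (k′+1) − sh k′ = ψ^{k′+1}∕8 ≠ 0`). [folklore] -/
theorem FnR_step_ne_birth (K k' : ℕ) : FnR K k' (k' + 1) ≠ FnR K k' k' := fun h => by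
  have h0 := congrFun h 0
  have ha : (ampR K k' : ℂ) ≠ 0 := by exact_mod_cast (ampR_pos K k').ne'
  have hs : (0 : ℝ) < ((LW ^ 2)⁻¹) ^ (k' + 1) / 8 := by have := psi_pos; positivity
  simp only [FnR, ev₀₀_zero, zero_add, shR, sub_self, add_sub_cancel_left] at h0
  have h1 := mul_left_cancel₀ ha h0
  have h2 : ((LW ^ 2)⁻¹) ^ (k' + 1) / 8 = 0 := by exact_mod_cast h1
  linarith

end Summit.QuantumFields.BalabanUV.T4Continuum.NE1p.DressedTowerWitnessRegen

end
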